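import Mathlib.Algebra.Polynomial.Derivative
import Mathlib.Algebra.Polynomial.Div
import Mathlib.Algebra.Ring.Action.Basic
import Mathlib.RingTheory.Ideal.Defs
import Mathlib.RingTheory.IntegralClosure.IsIntegral.Basic
import Mathlib.Tactic.LinearCombination
import Literature.NumberTheory.GaloisRepresentations.IntegralGaloisAction
import HarnessLib

/-!
# Inertia groups fix the roots of an integral polynomial that are simple modulo `𝔓`

Topic `NumberTheory/NumberFields`.  Theorem-only file (no definition, no named fact).

The elementary mechanism behind "a prime not dividing the discriminant of `g` is unramified in
the splitting field of `g`", in the form needed to show that inertia groups act trivially on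
the roots of an explicit polynomial:

* `sub_dvd_eval_derivative_of_isRoot` — in a domain, for two distinct roots `a ≠ b` of a
  polynomial `p`, `a - b ∣ p'(a)` (from `p = (X - a) q`, `q(b) = 0`, `p'(a) = q(a) = q(a) - q(b)`);
* `sub_dvd_of_quintic_eq_zero` — the same for an explicit monic quintic, polynomial-free;
* `smul_eq_self_of_mem_inertia_of_quintic` — if a group `G` acts on a domain `S` by ring
  automorphisms, `σ` lies in the inertia group of an ideal `𝔓`, `x ∈ S` is a root of a monic
  quintic `g` with integer coefficients and `v · g'(x) = N` with `N ∉ 𝔓` (an evaluated Bezout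
  identity `U g + V g' = N`), then `σ • x = x`: otherwise `σ • x` is another root of `g` congruent
  to `x` modulo `𝔓`, so `x - σ • x ∣ g'(x)` forces `N ∈ 𝔓`;
* `smul_eq_self_of_natCast_mul_eq` — fixed points propagate along integral polynomial
  expressions: `σ • y = y` and `D x = P(y)` (`P ∈ ℤ[X]`, `D ≠ 0`) give `σ • x = x`;
* `isIntegral_of_quintic_eq_zero` — a root of a monic integer quintic is integral.

These are the ingredients of the classical computation of inertia at the primes dividing the
index `[𝓞_K : ℤ[θ]]` via other integral generators (Dedekind's criterion in certificate form).

## References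

* J. Neukirch, *Algebraic Number Theory*, Grundlehren 322, Springer (1999), Ch. I §8
  (discriminants, (8.3)–(8.4)) and §9 (inertia groups, (9.6)). [NeukirchANT1999]
* H. Cohen, *A Course in Computational Algebraic Number Theory*, GTM 138 (1993), §3.3
  (resultants and the Bezout identity `U A + V A' = Res`) and §4.8. [Cohen1993]
-/

namespace Literature.NumberTheory.NumberFields

open Polynomial

/-- In a domain, if `a ≠ b` are two roots of a polynomial `p`, then `a - b` divides `p'(a)`:
writing `p = (X - a) q` one has `q(b) = 0` and `p'(a) = q(a) = q(a) - q(b)`.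
Ref: Neukirch, *Algebraic Number Theory*, Ch. I §8, proof of (8.4) (`disc = ∏ (θᵢ - θⱼ)²`,
`N(f'(θ))`). [folklore] -/
theorem sub_dvd_eval_derivative_of_isRoot {R : Type*} [CommRing R] [IsDomain R] {p : R[X]}
    {a b : R} (ha : p.IsRoot a) (hb : p.IsRoot b) (hab : a ≠ b) :
    a - b ∣ p.derivative.eval a := by
  obtain ⟨q, hq⟩ := dvd_iff_isRoot.mpr ha
  have hqb : q.eval b = 0 := by
    have h : p.eval b = 0 := hb
    rw [hq, eval_mul, eval_sub, eval_X, eval_C] at h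
    exact (mul_eq_zero.mp h).resolve_left (sub_ne_zero.mpr hab.symm)
  have hder : p.derivative.eval a = q.eval a := by
    rw [hq, derivative_mul, derivative_sub, derivative_X, derivative_C, sub_zero, one_mul,
      eval_add, eval_mul, eval_sub, eval_X, eval_C, sub_self, zero_mul, add_zero]
  rw [hder, ← sub_zero (q.eval a), ← hqb]
  exact sub_dvd_eval_sub a b q

/-- Polynomial-free form for a monic quintic `g = X⁵ + aX⁴ + bX³ + cX² + dX + e` over a domain:
if `x ≠ y` are roots of `g` then `x - y ∣ g'(x) = 5x⁴ + 4ax³ + 3bx² + 2cx + d`.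
Ref: Neukirch, *Algebraic Number Theory*, Ch. I §8, proof of (8.4). [folklore] -/
theorem sub_dvd_of_quintic_eq_zero {R : Type*} [CommRing R] [IsDomain R] {a b c d e x y : R}
    (hx : x ^ 5 + a * x ^ 4 + b * x ^ 3 + c * x ^ 2 + d * x + e = 0)
    (hy : y ^ 5 + a * y ^ 4 + b * y ^ 3 + c * y ^ 2 + d * y + e = 0) (hxy : x ≠ y) :
    x - y ∣ 5 * x ^ 4 + 4 * a * x ^ 3 + 3 * b * x ^ 2 + 2 * c * x + d := by
  -- `g(x) - g(y) = (x - y) H(x, y)` and `g'(x) - H(x, y) = (x - y) K(x, y)`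
  have hH : (x - y) * ((x ^ 4 + x ^ 3 * y + x ^ 2 * y ^ 2 + x * y ^ 3 + y ^ 4) +
      a * (x ^ 3 + x ^ 2 * y + x * y ^ 2 + y ^ 3) + b * (x ^ 2 + x * y + y ^ 2) +
      c * (x + y) + d) = 0 := by
    linear_combination hx - hy
  have hH0 := (mul_eq_zero.mp hH).resolve_left (sub_ne_zero.mpr hxy)
  exact ⟨(4 * x ^ 3 + 3 * x ^ 2 * y + 2 * x * y ^ 2 + y ^ 3) + a * (3 * x ^ 2 + 2 * x * y + y ^ 2) +
    b * (2 * x + y) + c, by linear_combination hH0⟩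

/-- **Inertia acts trivially on roots that are simple modulo `𝔓`.**  Let a group `G` act on a
domain `S` by ring automorphisms, let `σ` lie in the inertia group of the ideal `𝔓` (so
`σ • z ≡ z (mod 𝔓)` for all `z`), and let `x ∈ S` be a root of the monic integer quintic
`g = X⁵ + aX⁴ + bX³ + cX² + dX + e` such that `v · g'(x) = N` for some `v ∈ S` and `N ∉ 𝔓`
(e.g. the evaluation at `x` of a Bezout identity `U g + V g' = N` over `ℤ` with `p ∤ N`).  Then
`σ • x = x`: otherwise `σ • x` is a second root of `g` (the coefficients are integers, fixed by
`σ`) with `x - σ • x ∈ 𝔓`, and `x - σ • x ∣ g'(x)` would give `N ∈ 𝔓`.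
Ref: Neukirch, *Algebraic Number Theory*, Ch. I §8 (8.3)–(8.4) and §9 (9.6). [folklore] -/
theorem smul_eq_self_of_mem_inertia_of_quintic {S G : Type*} [CommRing S] [IsDomain S] [Group G]
    [MulSemiringAction G S] (𝔓 : Ideal S) {σ : G} (hσ : σ ∈ 𝔓.inertia G) {x v N : S}
    {a b c d e : ℤ} (hx : x ^ 5 + a * x ^ 4 + b * x ^ 3 + c * x ^ 2 + d * x + e = 0)
    (hbez : v * (5 * x ^ 4 + 4 * a * x ^ 3 + 3 * b * x ^ 2 + 2 * c * x + d) = N) (hN : N ∉ 𝔓) :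
    σ • x = x := by
  by_contra hne
  have hσx : (σ • x) ^ 5 + a * (σ • x) ^ 4 + b * (σ • x) ^ 3 + c * (σ • x) ^ 2 + d * (σ • x) + e
      = 0 := by
    have h := congrArg (MulSemiringAction.toRingHom G S σ) hx
    simpa only [map_add, map_mul, map_pow, map_intCast, map_zero,
      MulSemiringAction.toRingHom_apply] using h
  obtain ⟨k, hk⟩ := sub_dvd_of_quintic_eq_zero hx hσx (Ne.symm hne)
  have hmem : x - σ • x ∈ 𝔓 := by
    rw [← neg_sub]
    exact 𝔓.neg_mem (hσ x)
  refine hN ?_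
  rw [← hbez, hk]
  exact 𝔓.mul_mem_left v (𝔓.mul_mem_right k hmem)

/-- **Fixed points propagate along integral polynomial expressions.**  If `σ` acts on a domain
`S` by a ring endomorphism, `σ • y = y`, and `D x = r₀ + r₁ y + r₂ y² + r₃ y³ + r₄ y⁴` with
integers `rᵢ` and `D ≠ 0` in `S`, then `σ • x = x` (typically `x = R(y)` for `R ∈ ℚ[X]` with
denominator `D`). [folklore] -/
theorem smul_eq_self_of_natCast_mul_eq {S G : Type*} [CommRing S] [IsDomain S] [Monoid G]
    [MulSemiringAction G S] {σ : G} {x y : S} (hy : σ • y = y) {D : ℕ} (hD : (D : S) ≠ 0)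
    {r₀ r₁ r₂ r₃ r₄ : ℤ}
    (h : (D : S) * x = r₀ + r₁ * y + r₂ * y ^ 2 + r₃ * y ^ 3 + r₄ * y ^ 4) : σ • x = x := by
  refine mul_left_cancel₀ hD ?_
  have h2 := congrArg (MulSemiringAction.toRingHom G S σ) h
  simp only [map_add, map_mul, map_pow, map_intCast, map_natCast,
    MulSemiringAction.toRingHom_apply, hy] at h2
  rw [h2, h]

/-- A root of a monic quintic with integer coefficients is integral (over any base ring `R` of
the algebra in which it lives). [folklore] -/
theorem isIntegral_of_quintic_eq_zero {R A : Type*} [CommRing R] [CommRing A] [Algebra R A]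
    {x : A} (a b c d e : ℤ) (hx : x ^ 5 + a * x ^ 4 + b * x ^ 3 + c * x ^ 2 + d * x + e = 0) :
    IsIntegral R x := by
  refine ⟨X ^ 5 + C (a : R) * X ^ 4 + C (b : R) * X ^ 3 + C (c : R) * X ^ 2 + C (d : R) * X +
    C (e : R), by monicity!, ?_⟩
  simp only [eval₂_add, eval₂_mul, eval₂_X_pow, eval₂_C, eval₂_X]
  simpa only [map_intCast] using hx

/-! ### The certificate form over `ℤ̄ ⊆ K̄` -/

section AbsIntegers

open Literature.NumberTheory.GaloisRepresentations Field

/-- **Certificate for "inertia fixes a root".**  Let `x ∈ ℤ̄ = absIntegers R K ⊆ K̄`, `𝔓` an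
ideal of `ℤ̄`, `σ ∈ Gal(K̄/K)` in the inertia group of `𝔓`, and suppose given, with `t = x ∈ K̄`:
an element `b ∈ K̄` (in practice `b = B(t)` for some `B ∈ K[X]`) which is a root of a monic
integer quintic `g = X⁵ + a₄X⁴ + ⋯ + a₀`; integer polynomials `U` (cubic), `V` (quartic) and
`N ∈ ℕ` with `U g + V g' = N` identically on `ℤ̄` and `N ∉ 𝔓`; and an integer quartic `P` and
`D ∈ ℕ`, `D ≠ 0` in `K̄`, with `D t = P(b)`.  Then `σ • x = x`.  (Indeed `b` is integral, `σ`
fixes it by `smul_eq_self_of_mem_inertia_of_quintic`, hence fixes `t = P(b)/D`.)  This is the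
shape in which "`p ∤ [𝓞_K : ℤ[b]] · disc` ⇒ `p` unramified" is certified numerically.
Ref: Neukirch, *Algebraic Number Theory*, Ch. I §8 (8.3)–(8.4), §9 (9.6); Cohen, *A Course in
Computational Algebraic Number Theory*, §3.3 and §4.8. [folklore] -/
theorem absIntegers_smul_eq_self_of_certificate {R K : Type*} [CommRing R] [Field K] [Algebra R K]
    (𝔓 : Ideal (absIntegers R K)) {σ : absoluteGaloisGroup K}
    (hσ : σ ∈ 𝔓.inertia (absoluteGaloisGroup K)) {x : absIntegers R K}
    {t b : AlgebraicClosure K} (hxt : (x : AlgebraicClosure K) = t) {a₄ a₃ a₂ a₁ a₀ : ℤ}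
    (hgb : b ^ 5 + a₄ * b ^ 4 + a₃ * b ^ 3 + a₂ * b ^ 2 + a₁ * b + a₀ = 0)
    {u₀ u₁ u₂ u₃ v₀ v₁ v₂ v₃ v₄ : ℤ} {N : ℕ} (hN : (N : absIntegers R K) ∉ 𝔓)
    (hbez : ∀ y : absIntegers R K,
      (u₀ + u₁ * y + u₂ * y ^ 2 + u₃ * y ^ 3) *
          (y ^ 5 + a₄ * y ^ 4 + a₃ * y ^ 3 + a₂ * y ^ 2 + a₁ * y + a₀) +
        (v₀ + v₁ * y + v₂ * y ^ 2 + v₃ * y ^ 3 + v₄ * y ^ 4) *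
          (5 * y ^ 4 + 4 * a₄ * y ^ 3 + 3 * a₃ * y ^ 2 + 2 * a₂ * y + a₁) = N)
    {D : ℕ} (hD : (D : AlgebraicClosure K) ≠ 0) {r₀ r₁ r₂ r₃ r₄ : ℤ}
    (hR : (D : AlgebraicClosure K) * t = r₀ + r₁ * b + r₂ * b ^ 2 + r₃ * b ^ 3 + r₄ * b ^ 4) :
    σ • x = x := by
  subst hxt
  have hbint : b ∈ absIntegers R K :=
    (mem_integralClosure_iff _ _).mpr (isIntegral_of_quintic_eq_zero _ _ _ _ _ hgb)
  set β : absIntegers R K := ⟨b, hbint⟩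
  have hgβ : β ^ 5 + a₄ * β ^ 4 + a₃ * β ^ 3 + a₂ * β ^ 2 + a₁ * β + a₀ = 0 := by
    apply Subtype.val_injective
    change (absIntegers R K).val (β ^ 5 + a₄ * β ^ 4 + a₃ * β ^ 3 + a₂ * β ^ 2 + a₁ * β + a₀) =
      (absIntegers R K).val 0
    simp only [map_add, map_mul, map_pow, map_intCast, map_zero]
    exact hgb
  have hβσ : σ • β = β :=
    smul_eq_self_of_mem_inertia_of_quintic 𝔓 hσ hgβ
      (v := v₀ + v₁ * β + v₂ * β ^ 2 + v₃ * β ^ 3 + v₄ * β ^ 4)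
      (by linear_combination hbez β - (u₀ + u₁ * β + u₂ * β ^ 2 + u₃ * β ^ 3) * hgβ) hN
  have hbσ : σ • b = b := congrArg Subtype.val hβσ
  apply Subtype.ext
  rw [integralClosure.coe_smul]
  exact smul_eq_self_of_natCast_mul_eq hbσ hD hR

end AbsIntegers

end Literature.NumberTheory.NumberFields
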